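import Literature.AlgebraicGeometry.HodgeTheory.AbelianVarietyEndomorphismsHOne
import Literature.AlgebraicGeometry.Motives.AbelianVarietyCohomologyExteriorH1
import HarnessLib

/-!
# `[m]^* = mᵏ` on `Hᵏ(A(ℂ); ℂ)` for a complex abelian variety

Topic `AlgebraicGeometry/HodgeTheory` (namespace `Literature.AlgebraicGeometry.HodgeTheory`).

For a complex abelian variety `A` and `m : ℕ`, multiplication by `m` (the morphism `m • 𝟙 A` of the
preadditive category of abelian varieties) acts on `Hᵏ(A(ℂ); ℂ)` as the scalar `mᵏ` (Mumford,
*Abelian Varieties* §1 (3) with §19: `Hᵏ = ⋀ᵏH¹` and `[m]^* = m` on `H¹`; Milne, *Abelian varieties*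
(1986) Thm. 15.1 / proof of 8.2; Lange–Birkenhake Lemma 1.1.17, Exercise 1.1.6 (7)).

* `complexBetti_map_nsmul_id_one_apply` — degree one, PROVED unconditionally: `[m]^* c = m • c` on
  `H¹(A(ℂ); ℂ)` (the tree's additivity of `f ↦ f^*|_{H¹}`, `complexBetti_map_nsmul_id_add_nsmul_one`).
* `complexBetti_map_nsmul_id_apply_of_exteriorH1` — all degrees, from the fact
  `Motives.abelianVarietyCohomologyExteriorH1` taken as a hypothesis (`Hᵏ(A(ℂ); ℂ)` is spanned by cup
  products of degree-one classes): `[m]^* y = mᵏ • y` on `Hᵏ`, by naturality of iterated cup products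
  (`complexBetti_map_cupPowOne`) and multilinearity;
* `complexBetti_map_nsmul_id_apply` — the same UNCONDITIONALLY, the fact being discharged in the tree
  (`abelianVarietyCohomologyExteriorH1_holds`, Hopf's theorem for the compact group manifold `A(ℂ)`).

The last statement is VERBATIM the registered stub `stub_mulPow` of line `generic-ppav-secant-descent`
of crux `HeckePrymWeil.WeilTenfoldsSqrtMinus11` (stmt-HodgeConjecture-1262; lead
prover-line-stmt-HodgeConjecture-1262-0, cycle 1). Deliberately NOT here: the integral statement,
`[m]_*`, degrees of isogenies.

## References

* [MumfordAV1970] D. Mumford, *Abelian Varieties* (1970), §1 (3), §19.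
* [LangeBirkenhake1992] H. Lange, Ch. Birkenhake, *Complex Abelian Varieties* (1992), Lemma 1.1.17,
  Exercise 1.1.6 (7).
* [Hatcher2002] A. Hatcher, *Algebraic Topology* (2002), Prop. 3.10.
-/

noncomputable section

open CategoryTheory
open Literature.AlgebraicTopology.SingularHomology Literature.AlgebraicGeometry.Motives

namespace Literature.AlgebraicGeometry.HodgeTheory

/-- **`[m]^* = m` on `H¹(A(ℂ); ℂ)`**, element form: `(m • 𝟙 A)^* c = m • c` — the case `φ = 𝟙`,
`(x, y) = (m, 0)` of the proved additivity `complexBetti_map_nsmul_id_add_nsmul_one`.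
[cite: LangeBirkenhake1992, Lemma 1.1.17] -/
theorem complexBetti_map_nsmul_id_one_apply (A : Motives.AbelianVariety ℂ) (m : ℕ)
    (c : complexBetti A.X 1) :
    complexBetti.map (m • 𝟙 A).hom.hom.hom 1 c = (m : ℂ) • c := by
  have h := complexBetti_map_nsmul_id_add_nsmul_one (𝟙 A) m 0 c
  rw [zero_smul, add_zero] at h
  rw [h, Nat.cast_zero, zero_smul, add_zero]

/-- **`[m]^* = mᵏ` on `Hᵏ(A(ℂ); ℂ)`** for every complex abelian variety `A` and all `m k : ℕ`, GIVEN
the named fact `abelianVarietyCohomologyExteriorH1` (`Hᵏ` is spanned by the products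
`v₀ ⌣ ⋯ ⌣ v_{k-1}` of degree-one classes): on such a product `[m]^*` acts factorwise by `m`
(`complexBetti_map_cupPowOne`, `complexBetti_map_nsmul_id_one_apply`), hence by `mᵏ`
(multilinearity), and both sides are `ℂ`-linear in `y`. This is verbatim the registered stub
`stub_mulPow` of crux stmt-HodgeConjecture-1262 (line `generic-ppav-secant-descent`).
[cite: MumfordAV1970, §1 (3) and §19] -/
theorem complexBetti_map_nsmul_id_apply_of_exteriorH1 (h : abelianVarietyCohomologyExteriorH1) :
    ∀ (Y : AbelianVariety ℂ) (m k : ℕ) (y : complexBetti Y.X k),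
      complexBetti.map (m • 𝟙 Y).hom.hom.hom k y = ((m : ℂ) ^ k) • y := by
  intro Y m k y
  -- the two `ℂ`-linear maps `[m]^*` and `mᵏ • id` agree on the spanning products of `H¹`-classes
  have key : ∀ v : Fin k → complexBetti Y.X 1,
      complexBetti.map (m • 𝟙 Y).hom.hom.hom k (cupPowOne ℂ (ComplexPoints Y.X) k v) =
        ((m : ℂ) ^ k) • cupPowOne ℂ (ComplexPoints Y.X) k v := by
    intro v
    rw [complexBetti_map_cupPowOne]
    have hv : (fun i => complexBetti.map (m • 𝟙 Y).hom.hom.hom 1 (v i)) = fun i => (m : ℂ) • v i :=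
      funext fun i => complexBetti_map_nsmul_id_one_apply Y m (v i)
    rw [hv, MultilinearMap.map_smul_univ, Finset.prod_const, Finset.card_univ, Fintype.card_fin]
  have hspan := (h.hasExteriorCohomologyH1 Y).span_range_cupPowOne k
  have hy : y ∈ Submodule.span ℂ (Set.range (cupPowOne ℂ (ComplexPoints Y.X) k)) := by
    rw [hspan]; exact Submodule.mem_top
  induction hy using Submodule.span_induction with
  | mem x hx =>
    obtain ⟨v, rfl⟩ := hx
    exact key v
  | zero => rw [map_zero, smul_zero]
  | add a b _ _ ha hb => rw [map_add, smul_add, ha, hb]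
  | smul r a _ ha => rw [map_smul, ha, smul_comm]

/-- **`[m]^* = mᵏ` on `Hᵏ(A(ℂ); ℂ)`, unconditionally** (Mumford §1 (3), §19; Milne 1986 Thm. 15.1):
`complexBetti_map_nsmul_id_apply_of_exteriorH1` fed the discharged fact
`abelianVarietyCohomologyExteriorH1_holds`. [cite: MumfordAV1970, §1 (3) and §19] -/
theorem complexBetti_map_nsmul_id_apply :
    ∀ (Y : AbelianVariety ℂ) (m k : ℕ) (y : complexBetti Y.X k),
      complexBetti.map (m • 𝟙 Y).hom.hom.hom k y = ((m : ℂ) ^ k) • y :=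
  complexBetti_map_nsmul_id_apply_of_exteriorH1 abelianVarietyCohomologyExteriorH1_holds

end Literature.AlgebraicGeometry.HodgeTheory

end
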